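import Summits.CriticalPhenomena.PercolationContinuityZ3.Theorems.Transplant.PlanarSkeletonFrmQuasiDefs
import Summits.CriticalPhenomena.PercolationContinuityZ3.Theorems.Transplant.SkelFrmQuasiBParamsSchedAT
import Summits.CriticalPhenomena.PercolationContinuityZ3.Theorems.Transplant.SkelFrmBParamsSchedAT
import Summits.CriticalPhenomena.PercolationContinuityZ3.Theorems.Transplant.SkelFrmQuasiBParamsExcess
import Summits.CriticalPhenomena.PercolationContinuityZ3.Theorems.Transplant.SkelFrmBParamsExcess
import Summits.CriticalPhenomena.PercolationContinuityZ3.Theorems.Transplant.SkelPhiFatRadius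
import Summits.CriticalPhenomena.PercolationContinuityZ3.Theorems.Transplant.SkelConcRootRadii
import Summits.CriticalPhenomena.PercolationContinuityZ3.Theorems.Transplant.SkelNegBParamsSlotsSU
import Summits.CriticalPhenomena.PercolationContinuityZ3.Theorems.Transplant.SkelFrmQuasiBParamsSlotsS
import Summits.CriticalPhenomena.PercolationContinuityZ3.Theorems.Transplant.SkelFrmBParamsSlotsS
import Summits.CriticalPhenomena.PercolationContinuityZ3.Theorems.Transplant.SkelFrmQuasiBChoiceDefsT
import Summits.CriticalPhenomena.PercolationContinuityZ3.Theorems.Transplant.SkelFrmQuasi1SlotTypes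
import HarnessLib
import Summits.CriticalPhenomena.PercolationContinuityZ3.Theorems.Transplant.SkelFrmBParamsSlotsST
/-!
# GEN-Q PORT (WAVE-Q table v0.8 section 2, row G075, U-level L11; captain R-6/R-7 2026-08-27: carrier token swap `PlanarSkeletonFrmFrom ↦ PlanarSkeletonFrmQuasi`)
# of the tree module «Transplant/SkelFrmFromBParamsSlotsST» (sha256 c2884603a59b4d20…) onto the quasi-step carrier `PlanarSkeletonFrmQuasi` (p507026): «SkelFrmQuasiBParamsSlotsST»

ORIGINAL TITLE: (R-40) `…T` TWIN (stmt-g21, 2026-08-23; ruling p3-g16 06:23:56Z, J18; lead g11 06:35:07Z: the choice function of record moves to `frmChoiceAllQ3T`): the twin of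

builds on p205010 (kernel theorem, internal audit signed; external expert review pending) — nothing in this file uses p205010; NOTHING is claimed about any open node
((N3-b), the end state).  Lane `prim-bschramm`, seat `prim-bschramm-stmt` (gen 33; GEN-Q column pen; tool = captain gen-1 g4's port_genq.py R-14 --cone + p3-g30's T1 patch).  Helper file (`--supports stmt-CriticalPhenomena-4575 --as helper`).
PORT RULES (U-wave r1–r4 re-used, GEN-Q hunk classes of p3-g29 #6136): declaration order, names and proof texts are those of «SkelFrmFromBParamsSlotsST», byte-identical except
(i) the carrier token `PlanarSkeletonFrmFrom ↦ PlanarSkeletonFrmQuasi` in binders, `namespace`/`end` lines and qualified names (module names `SkelFrmFrom… ↦ SkelFrmQuasi…`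
in imports of already-ported rows); (ii) `Φ.step ↦ Φ.qstep` with the called Steps lemma replaced by its `…Q`/`_q` twin and the cost `Φ.M` threaded (none in this file unless
listed below); (iii) `Φ.cyl_connected ↦ Φ.cyl_reach` readers (none unless listed); (iv) graph-ball radii / window floors ×`Φ.M` (none unless listed).  Carrier-free
residents stay imported/exported from the original «SkelFrmBParamsSlotsST» exactly as in the FrmFrom port.  Docstrings and citations are the original's.

-/

noncomputable section

open scoped Classical

namespace Summit.CriticalPhenomena.PercolationContinuityZ3.Theorems.Transplant

namespace PlanarSkeletonFrmQuasi

namespace NegB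

open MeasureTheory Literature.Probability.Percolation Literature.Probability.LatticeModels SimpleGraph
open Literature.Barriers.CriticalPhenomena (graphBall)
open SkelConc (Consts)
open BoxProdZ2 (ConcRadiiG Erad Frad nQ)
open Skelφ (oriφ trφ)
open Skelφ.StepI (DataN DataNS)
open Skel (excess)
open Neg

/-! ## §1 The residual slot type, the seed's fat radius, the φ-diameter of a rim habitat -/

-- (cell-free, not re-declared: `GSlot` of SkelFrmBParamsSlotsS)

-- (cell-free, not re-declared: `GSlot.zero` of SkelFrmBParamsSlotsS)

-- (cell-free, not re-declared: `ψπ` of SkelFrmBParamsSlotsS)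

-- (cell-free, not re-declared: `ψπ_eq` of SkelFrmBParamsSlotsS)

section Values

variable (κ : Consts) {V : Type} [DecidableEq V] [Countable V] {G : SimpleGraph V} [G.LocallyFinite] (Φ : PlanarSkeletonFrmQuasi G) (t : V)
  (p : unitInterval) (D : DataNS V) (g f mx : ℕ)

-- (cell-free, not re-declared: `mRS` of SkelFrmBParamsSlotsS)

-- (cell-free, not re-declared: `mRS_ge` of SkelFrmBParamsSlotsS)

-- (cell-free, not re-declared: `fine_diam_le_mRS` of SkelFrmBParamsSlotsS)

end Values

/-! ## §2 The fibre block of record over the staggered cells -/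

-- (cell-free, not re-declared: `SUS` of SkelFrmBParamsSlotsS)

section Facts

variable (κ : Consts) {V : Type} [DecidableEq V] [Countable V] {G : SimpleGraph V} [G.LocallyFinite] (Φ : PlanarSkeletonFrmQuasi G) (t : V)
  (p : unitInterval) (D : DataNS V) (g f : ℕ) (ex mx : GSlot) (q : unitInterval)

-- (cell-free, not re-declared: `SUS_fields` of SkelFrmBParamsSlotsS)

-- (cell-free, not re-declared: `SUS_rmax_ge` of SkelFrmBParamsSlotsS)

-- (cell-free, not re-declared: `hgap20_US` of SkelFrmBParamsSlotsS)

-- (cell-free, not re-declared: `hgapc_US` of SkelFrmBParamsSlotsS)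

-- (cell-free, not re-declared: `hgapR_US` of SkelFrmBParamsSlotsS)

-- (cell-free, not re-declared: `hgapL_US` of SkelFrmBParamsSlotsS)

-- (cell-free, not re-declared: `ex_le_Lp_US` of SkelFrmBParamsSlotsS)

-- (cell-free, not re-declared: `three_le_E₀_US` of SkelFrmBParamsSlotsS)

-- (cell-free, not re-declared: `hsch_US` of SkelFrmBParamsSlotsS)

-- (cell-free, not re-declared: `Rex_mono_US` of SkelFrmBParamsSlotsS)

-- (cell-free, not re-declared: `hR₁_US` of SkelFrmBParamsSlotsS)

-- (cell-free, not re-declared: `hRex_US` of SkelFrmBParamsSlotsS)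

-- (cell-free, not re-declared: `hR₁_US_η` of SkelFrmBParamsSlotsS)

-- (cell-free, not re-declared: `E₀_SUS_eq` of SkelFrmBParamsSlotsS)

-- (cell-free, not re-declared: `Lp_SUS_eq` of SkelFrmBParamsSlotsS)

end Facts

/-! ## §3 The root radius `Rπ := E₀ − 1` (any block) and the four root radii at the schedule of record -/

section RootRadii

variable (κ : Consts) {V : Type} [DecidableEq V] [Countable V] {G : SimpleGraph V} [G.LocallyFinite] (Φ : PlanarSkeletonFrmQuasi G) (t : V)
  (p : unitInterval) (D : DataNS V) (g f : ℕ) (c : Fin 2 → ℕ) (Sv : SSlot) (q : unitInterval)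

-- (cell-free, not re-declared: `Rπ` of SkelFrmBParamsSlotsS)

-- (cell-free, not re-declared: `Rπ_succ` of SkelFrmBParamsSlotsS)

/-- **`hRQ`**: `Rπ + 1 ≤ rQ 0 0` (`rQ 0 0 = E (nQ 0 0) ⊔ … ≥ E₀`). [folklore] -/
theorem hRQ_RT (κ : Consts) {V : Type} [DecidableEq V] [Countable V] {G : SimpleGraph V} [G.LocallyFinite] (Φ : PlanarSkeletonFrmQuasi G) (t : V) (p : unitInterval) (D : DataNS V) (g : ℕ) (f : ℕ) (c : Fin 2 → ℕ) (Sv : SSlot) (q : unitInterval) : Rπ κ Φ t p D g f Sv q + 1 ≤ (schedOfT κ Φ t p D g f c (Sv κ Φ t p D g f q)).rQ 0 0 := by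
  rw [Rπ_succ]
  show _ ≤ max (Erad (Skelφ.Prm.gap (Sv κ Φ t p D g f q)) (fun _ => 0) (Skelφ.Prm.E₀ (Sv κ Φ t p D g f q)) (nQ 0 0)) _
  exact le_trans (Skel.E₀_le_Erad _ _ _ _) (le_max_left _ _)

/-- **`hRB`**: `Rπ + 1 ≤ rB 0 0 du` (`= E (nQ 0 (0+du))`). [folklore] -/
theorem hRB_RT (κ : Consts) {V : Type} [DecidableEq V] [Countable V] {G : SimpleGraph V} [G.LocallyFinite] (Φ : PlanarSkeletonFrmQuasi G) (t : V) (p : unitInterval) (D : DataNS V) (g : ℕ) (f : ℕ) (c : Fin 2 → ℕ) (Sv : SSlot) (q : unitInterval) (du : MDir) : Rπ κ Φ t p D g f Sv q + 1 ≤ (schedOfT κ Φ t p D g f c (Sv κ Φ t p D g f q)).rB 0 0 du := by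
  rw [Rπ_succ]
  show _ ≤ Erad (Skelφ.Prm.gap (Sv κ Φ t p D g f q)) (fun _ => 0) (Skelφ.Prm.E₀ (Sv κ Φ t p D g f q)) (nQ 0 (0 + stepVec du))
  exact Skel.E₀_le_Erad _ _ _ _

/-- **`hRQ′`**: `Rπ + 1 ≤ rQ 0 (0 + du)`. [folklore] -/
theorem hRQ'_RT (κ : Consts) {V : Type} [DecidableEq V] [Countable V] {G : SimpleGraph V} [G.LocallyFinite] (Φ : PlanarSkeletonFrmQuasi G) (t : V) (p : unitInterval) (D : DataNS V) (g : ℕ) (f : ℕ) (c : Fin 2 → ℕ) (Sv : SSlot) (q : unitInterval) (du : MDir) : Rπ κ Φ t p D g f Sv q + 1 ≤ (schedOfT κ Φ t p D g f c (Sv κ Φ t p D g f q)).rQ 0 ((0 : Site 2) + stepVec du) := by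
  rw [Rπ_succ]
  show _ ≤ max (Erad (Skelφ.Prm.gap (Sv κ Φ t p D g f q)) (fun _ => 0) (Skelφ.Prm.E₀ (Sv κ Φ t p D g f q)) (nQ 0 ((0 : Site 2) + stepVec du))) _
  exact le_trans (Skel.E₀_le_Erad _ _ _ _) (le_max_left _ _)

/-- **`hRM`**: `Rπ + 1 ≤ rM 0 (0 + du)` (`rM 0 (0+du) = F 1 − L′ = E₀ + gap E₀ − L′ ≥ E₀` since `L′ ≤ gap`). [folklore] -/
theorem hRM_RT (κ : Consts) {V : Type} [DecidableEq V] [Countable V] {G : SimpleGraph V} [G.LocallyFinite] (Φ : PlanarSkeletonFrmQuasi G) (t : V) (p : unitInterval) (D : DataNS V) (g : ℕ) (f : ℕ) (c : Fin 2 → ℕ) (Sv : SSlot) (q : unitInterval) (du : MDir) : Rπ κ Φ t p D g f Sv q + 1 ≤ (schedOfT κ Φ t p D g f c (Sv κ Φ t p D g f q)).rM 0 ((0 : Site 2) + stepVec du) := by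
  rw [Rπ_succ]
  show _ ≤ Frad (Skelφ.Prm.gap (Sv κ Φ t p D g f q)) (fun _ => 0) (Skelφ.Prm.E₀ (Sv κ Φ t p D g f q)) (nQ 0 ((0 : Site 2) + stepVec du)) - Skelφ.Prm.Lp (Sv κ Φ t p D g f q)
  rw [Skel.nQ_zero_stepVec, BoxProdZ2.Frad_succ, BoxProdZ2.Erad_zero]
  have h := Skelφ.Prm.hgapL (Sv κ Φ t p D g f q) (Skelφ.Prm.E₀ (Sv κ Φ t p D g f q))
  omega

-- (cell-free, not re-declared: `le_Rπ_of` of SkelFrmBParamsSlotsS)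

-- (cell-free, not re-declared: `le_Rπ_of_reachK` of SkelFrmBParamsSlotsS)

end RootRadii

/-! ## §4 The `Rπ`-inequalities of the root residue at `SUS`, as floors on `ex` -/

section RootSU

variable (κ : Consts) {V : Type} [DecidableEq V] [Countable V] {G : SimpleGraph V} [G.LocallyFinite] (Φ : PlanarSkeletonFrmQuasi G) (t : V)
  (p : unitInterval) (D : DataNS V) (g f : ℕ) (ex mx : GSlot) (q : unitInterval)

-- (cell-free, not re-declared: `ex_le_Rπ` of SkelFrmBParamsSlotsS)

-- (cell-free, not re-declared: `fat_le_Rπ` of SkelFrmBParamsSlotsS)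

-- (cell-free, not re-declared: `Rex_fat_le_Rπ_sub` of SkelFrmBParamsSlotsS)

-- (cell-free, not re-declared: `SRex_fat_le_Rπ_sub` of SkelFrmBParamsSlotsS)

end RootSU

end NegB

end PlanarSkeletonFrmQuasi

end Summit.CriticalPhenomena.PercolationContinuityZ3.Theorems.Transplant

end
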